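/-
Copyright (c) 2026 the pub-hodgecm-mathlib formalisation cell (harness21).  Prover seat hodgecm-mathlib-B-p04 (g61), req618 STAGE 1a «FOUR-FRAME» squad, Track A TIER 2
for the tier-1 socket `U1_Frames` (this seat's unit as assembler): the payment of `stub_U1_exists_axisStable_vertex_dist_le` — A-2↓.  2026-09-03.
-/
import Literature.NumberTheory.Automorphic.UnitaryThreeFourFrameAxisTypeTwoStep   -- ★ p854750 (B-p04): BRICK 3, the ONE-STEP LEMMA `exists_axisStable_vertex_eq_or_adj`; brings ★ BRICKS 1–2, #0a DEFS-1
import Mathlib.Combinatorics.SimpleGraph.Metric                                  -- `SimpleGraph.dist`, `SimpleGraph.dist_le`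
import HarnessLib

/-!
# (D-RAM) «FOUR-FRAME» road, unit (i), TIER 2: A-2↓ — a `π`-stable vertex within distance `c` of every vertex of axis exponent `≤ c`
# (payment of `U1_Frames.stub_U1_exists_axisStable_vertex_dist_le`)

Cell `pub/hodgecm-mathlib`, crux H413 (`stub_DyRamCore`); FOUR-FRAME road (LEAD directive v1.2 (R-9)∕(R-10)), tier-1 socket ★ `Cruxes/H413/Lines/F0_P3c_DyRamFourFrame_U1_Frames.lean`
(B-p04 (g61)), stub U1-2.  BRICK 4 of 4: the induction on `c` over BRICKS 1–3 (★ `UnitaryThreeFourFrameAxisDescentSelfDual` p854730, ★ `…AxisUpStep` p854737,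
★ `…AxisTypeTwoStep` p854750 — all abstract-`K` Literature bricks).

THE MATHEMATICS (Kottwitz 1986 §1; Serre, *Trees* II.1.1; Bruhat–Tits 1972 §10).  `π = π_i^{(b)}` is the `Φ₃`-orthogonal projection onto the anisotropic line `K·f_{b,i}`; a vertex
`Λ` has AXIS EXPONENT `≤ c` when `ϖ^c·π·Λ ⊆ Λ` (`AxisStable ϖ π Λ c`).  THE ONE-STEP LEMMA (★ `exists_axisStable_vertex_eq_or_adj`): from a vertex with exponent `≤ c+1`
to an EQUAL OR ADJACENT vertex with exponent `≤ c` — at a self-dual `L` one DESCENDS to `L ∩ (ϖ^cπ)⁻¹L`, at a type-2 `M` one ASCENDS to `M + (M^♯ ∩ Kf)` (legal because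
`ϖ^{c+1}πM ⊆ M` forces `ϖ^cπM ⊆ M^♯` at type 2, by the line property of `M∕ϖM^♯`); both use only: `σ` an isometric involution with even-valued fixed elements, `ϖ` a
uniformiser, `N(f) ≠ 0` — conjuncts 1–4 of ★ `IsRamifiedQuadraticDatum` and conjunct 2 of ★ `IsFourFrameFamily`.  Iterating `c` times gives a WALK of length `≤ c` to a
`π`-stable vertex, hence `Reachable` and `dist ≤ c` (★ `SimpleGraph.dist_le`; no connectedness is used).

* §1 `exists_axisStable_vertex_walk` — the induction, producing an explicit walk.
* §2 `exists_axisStable_vertex_dist_le` — THE STUB STATEMENT, token for token (`U1_Frames.stub_U1_exists_axisStable_vertex_dist_le`).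

HONEST LABEL: HC_CM is proved only modulo the 7 printed citations (2 remaining named inputs: hLiu418 = stmt-HodgeConjecture-24832, h413 = stmt-HodgeConjecture-24833) until rung 0
closes; this file is a `--supports stmt-HodgeConjecture-24833` helper paying one registered tier-1 stub; it closes nothing by itself.
-/

noncomputable section

open scoped Valued WithZero Matrix MatrixGroups

namespace Summit.HodgeConjecture.HodgeConjecture.Cruxes.H413.F0P3cDyRamAxisStableVertexDistLe

open Literature.NumberTheory.Automorphic Literature.NumberTheory.Automorphic.HermitianLattice
  Literature.NumberTheory.Automorphic.UnitaryLatticeTree Literature.NumberTheory.Automorphic.UnitaryThreeFourFrame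

variable {K : Type} [Field K] [Valued K ℤᵐ⁰]

/-! ## §1  The induction: a walk of length `≤ c` to a `π`-stable vertex -/

/-- **A-2↓ WITH AN EXPLICIT WALK**: from every vertex `Λ` with `ϖ^c·π·Λ ⊆ Λ` there is a walk of length `≤ c` in the lattice graph to a vertex `M` with `π·M ⊆ M` — `c` applications
of the one-step lemma ★ `exists_axisStable_vertex_eq_or_adj`. [cite: Kottwitz1986BaseChangeUnits, §1 pp. 240–241] [cite: Serre1980Trees, II.1.1] [cite: BruhatTits1972, §10] -/
theorem exists_axisStable_vertex_walk {σ : K →+* K} (hσσ : ∀ a, σ (σ a) = a) (hvσ : ∀ a, Valued.v (σ a) = Valued.v a) {ϖ : K}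
    (hϖ : Valued.v ϖ = WithZero.exp (-1 : ℤ)) (heven : ∀ x : K, σ x = x → x ≠ 0 → ∃ n : ℤ, Valued.v x = WithZero.exp (2 * n))
    {f : Fin 3 → K} (hf : pairing σ ((StdForm.antidiagonal 3).over K) f f ≠ 0) :
    ∀ (c : ℕ) (Λ : Submodule 𝒪[K] (Fin 3 → K)) (hΛ : IsVertex σ ϖ ((StdForm.antidiagonal 3).over K) Λ), AxisStable ϖ (frameProj σ f) Λ c →
      ∃ (M : Submodule 𝒪[K] (Fin 3 → K)) (hM : IsVertex σ ϖ ((StdForm.antidiagonal 3).over K) M), AxisStable ϖ (frameProj σ f) M 0 ∧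
        ∃ w : (latticeGraph σ ϖ ((StdForm.antidiagonal 3).over K)).Walk ⟨Λ, hΛ⟩ ⟨M, hM⟩, w.length ≤ c := by
  intro c
  induction c with
  | zero =>
    intro Λ hΛ h
    exact ⟨Λ, hΛ, h, SimpleGraph.Walk.nil, le_rfl⟩
  | succ c ih =>
    intro Λ hΛ h
    obtain ⟨L, hL, hTL, hor⟩ := exists_axisStable_vertex_eq_or_adj hσσ hvσ hϖ heven hf hΛ h
    obtain ⟨M, hM, hM0, w, hw⟩ := ih L hL hTL
    rcases hor with rfl | hadj
    · exact ⟨M, hM, hM0, w, hw.trans (Nat.le_succ c)⟩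
    · exact ⟨M, hM, hM0, SimpleGraph.Walk.cons hadj w, by rw [SimpleGraph.Walk.length_cons]; omega⟩

/-! ## §2  The stub statement -/

/-- **U1-2 · A-2↓: A `π`-STABLE VERTEX WITHIN DISTANCE `c` OF EVERY VERTEX WITH AXIS EXPONENT `≤ c`** — for every wild datum, four-frame family, frame `b`, slot `i`, vertex `Λ`
and `c` with `ϖ^c·π_i^{(b)}·Λ ⊆ Λ`, there is a `π_i^{(b)}`-stable vertex `M` REACHABLE from `Λ` in the lattice graph of `(K³, Φ₃)` with `dist(Λ, M) ≤ c`.  The statement is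
`U1_Frames.stub_U1_exists_axisStable_vertex_dist_le` TOKEN FOR TOKEN; the proof is §1 (the walk gives reachability and bounds the distance, ★ `SimpleGraph.dist_le`).
[cite: Kottwitz1986BaseChangeUnits, §1 pp. 240–241] [cite: Serre1980Trees, II.1.1] [cite: BruhatTits1972, §10] -/
theorem exists_axisStable_vertex_dist_le :
    ∀ {K : Type} [Field K] [Valued K ℤᵐ⁰] [CompleteSpace K] (σ : K →+* K) (ϖ : K) (d t : ℕ), IsRamifiedQuadraticDatum σ ϖ d t →
      ∀ (f : Fin 4 → Fin 3 → (Fin 3 → K)), IsFourFrameFamily σ f → ∀ (b : Fin 4) (i : Fin 3)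
        (Λ : Submodule 𝒪[K] (Fin 3 → K)) (hΛ : IsVertex σ ϖ ((StdForm.antidiagonal 3).over K) Λ) (c : ℕ),
        AxisStable ϖ (frameProj σ (f b i)) Λ c →
        ∃ (M : Submodule 𝒪[K] (Fin 3 → K)) (hM : IsVertex σ ϖ ((StdForm.antidiagonal 3).over K) M),
          AxisStable ϖ (frameProj σ (f b i)) M 0 ∧ (latticeGraph σ ϖ ((StdForm.antidiagonal 3).over K)).Reachable ⟨Λ, hΛ⟩ ⟨M, hM⟩ ∧
          (latticeGraph σ ϖ ((StdForm.antidiagonal 3).over K)).dist ⟨Λ, hΛ⟩ ⟨M, hM⟩ ≤ c := by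
  intro K _ _ _ σ ϖ d t hD f hf b i Λ hΛ c hc
  obtain ⟨hσσ, hvσ, hϖ, heven, -, -, -⟩ := hD
  obtain ⟨M, hM, hM0, w, hw⟩ := exists_axisStable_vertex_walk hσσ hvσ hϖ heven ((hf b).2.1 i) c Λ hΛ hc
  exact ⟨M, hM, hM0, ⟨w⟩, (SimpleGraph.dist_le w).trans hw⟩

end Summit.HodgeConjecture.HodgeConjecture.Cruxes.H413.F0P3cDyRamAxisStableVertexDistLe
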